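import Mathlib
import HarnessLib
import Summits.HubbardSuperconductivity.HubbardSuperconductivity.Theorems.KLProgrammeKLRegimeVolumeLimitNestedGeneric
import Summits.HubbardSuperconductivity.HubbardSuperconductivity.Theorems.KLProgrammeKLRegimeVolumeLimitSixLabelDecay

/-!
# VL children — PER-LABEL nested rates suffice: the Matsubara-label uniformity of the carrier export is FREE
# (cell gate-hubbard-kl, seat hubbard-kl-k3c5-p3 g5, technique «OS-positivity-free direct assembly»; `--supports` stmt-…-19921)

The registered carrier export of the VL child («cauchy» v3 `stub_vl_carrierRate`, and its nested form `carrierRateText_of_nested`) asks for a rate `ρ L`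
UNIFORM in the Matsubara label.  k3c5-p1's Hartree sum rule with an `L`-uniform remainder (`norm_klSelfEnergyInf_zero_sub_sub_le`, p501364: for every `U`,
`‖(Σ∞⁰_L(n,p) − Σ∞⁰_{L′}(n,p′)) − U(occ∞(L) − occ∞(L′))‖ ≤ 9U²/|k₀(n)|`, `k₀(n) = π(2n+1)/β`) makes that uniformity automatic: beyond a label window the
two-volume difference of the carrier IS `U` times that of the density, which in turn is read off at ANY ONE label of the window.  A diagonal choice of a
growing window `|n| ≤ N(L)`, `N(L) → ∞`, on which the per-label rates are simultaneously small (`exists_labelWindow`) then gives a label-uniform rate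
`δ(L) + 18U²/k₀(N(L)) → 0`.

* `exists_labelWindow` — for a family of null sequences `ρ_n → 0` (`n : ℤ`) there are `N(L) → ∞` and `δ(L) → 0` with `ρ_n(L) ≤ δ(L)` for `|n| ≤ N(L)`;
* `nestedRateInf_uniform_of_perLabel` — cutoff-free: PER-LABEL nested same-momentum comparability of the bare carrier `klSelfEnergyInf L β U μ 0 n`
  (`∀ n, ∃`-free: rates `ρ n` with `ρ n → 0` for each `n`) ⇒ a label-UNIFORM nested rate (every real `U`, `β > 0`);
* `carrierRateText_of_perLabelNested` — **the carrier-export text of a VL child (any bundle `Pr`, window `W`; at `klPredsV14`/`klWindowC` it is the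
  registered `stub_vl_carrierRate` VERBATIM) from (Nₙ) PER-LABEL nested finite-cutoff comparability
  `∀ n, … ∃ M₀ ∀ M ≥ M₀ ∀ ω, matsubaraInt M ω = n → p_{k″} = p_k → ‖Σ̂⁰_{L,M}(ω,k) − Σ̂⁰_{L″,M}(ω,k″)‖ ≤ ρ n L` (`ρ n → 0` for each `n`, common `L₀`) and
  (M) the one-volume momentum modulus** — i.e. the engine lineage may run its two-volume pass ONE MATSUBARA LABEL AT A TIME with label-dependent constants.

Everything is proved; no definition; nothing is asserted about the model.
-/

noncomputable section

namespace Summit.HubbardSuperconductivity.HubbardSuperconductivity.Theorems.TwoPointAssembly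

set_option linter.dupNamespace false -- summit = problem name (single-conjunct summit), D-0017

open Finset Filter Topology Literature.MathematicalPhysics.QuantumLattice Literature.Probability.LatticeModels
open Literature.MathematicalPhysics.QuantumLattice.FermiRG
open Summit.HubbardSuperconductivity.HubbardSuperconductivity.Theorems.DispersionFlow
open Summit.HubbardSuperconductivity.HubbardSuperconductivity.Theorems.KLRegimeSplit
open Summit.HubbardSuperconductivity.HubbardSuperconductivity.Theorems.KLProgrammeLegKernels
open Summit.HubbardSuperconductivity.HubbardSuperconductivity.Theorems.KLRegimeVolumeLimit (kler_carrierRate_of_sameCutoff)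

/-! ## §1 A growing label window on which countably many null sequences are simultaneously small -/

/-- **Diagonal window.**  For null sequences `ρ n → 0` indexed by `n : ℤ` there are a window size `N(L) → ∞` and a bound `δ(L) → 0`, `δ ≥ 0`, with
`ρ n L ≤ δ L` whenever `|n| ≤ N L`. [folklore] -/
theorem exists_labelWindow {ρ : ℤ → ℕ → ℝ} (hρ : ∀ n, Tendsto (ρ n) atTop (𝓝 0)) :
    ∃ N : ℕ → ℕ, ∃ δ : ℕ → ℝ, Tendsto N atTop atTop ∧ Tendsto δ atTop (𝓝 0) ∧ (∀ L, 0 ≤ δ L) ∧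
      ∀ (L : ℕ) (n : ℤ), n.natAbs ≤ N L → ρ n L ≤ δ L := by
  classical
  -- window sums `σ K L = Σ_{|n| ≤ K} max (ρ n L) 0`
  set σ : ℕ → ℕ → ℝ := fun K L => ∑ n ∈ Finset.Icc (-(K : ℤ)) K, max (ρ n L) 0 with hσ
  have hσ0 : ∀ K, Tendsto (σ K) atTop (𝓝 0) := by
    intro K
    have h : Tendsto (fun L => ∑ n ∈ Finset.Icc (-(K : ℤ)) K, max (ρ n L) 0) atTop (𝓝 (∑ _n ∈ Finset.Icc (-(K : ℤ)) K, (0 : ℝ))) :=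
      tendsto_finsetSum _ fun n _ => by simpa using (hρ n).max (tendsto_const_nhds (x := (0 : ℝ)))
    simpa [hσ] using h
  have hσnn : ∀ K L, 0 ≤ σ K L := fun K L => Finset.sum_nonneg fun n _ => le_max_right _ _
  have hρσ : ∀ (K L : ℕ) (n : ℤ), n.natAbs ≤ K → ρ n L ≤ σ K L := by
    intro K L n hn
    have hmem : n ∈ Finset.Icc (-(K : ℤ)) K := by
      simp only [Finset.mem_Icc]; omega
    exact (le_max_left _ _).trans (Finset.single_le_sum (f := fun n => max (ρ n L) 0) (fun n _ => le_max_right _ _) hmem)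
  -- the window: the largest `K ≤ L` with `σ K L ≤ 1/(K+1)`
  set N : ℕ → ℕ := fun L => Nat.findGreatest (fun K => σ K L ≤ 1 / ((K : ℝ) + 1)) L with hN
  have hev : ∀ K₀ : ℕ, ∀ᶠ L in atTop, K₀ ≤ L ∧ σ K₀ L ≤ 1 / ((K₀ : ℝ) + 1) := by
    intro K₀
    have h1 : ∀ᶠ L : ℕ in atTop, K₀ ≤ L := eventually_ge_atTop K₀
    have h2 : ∀ᶠ L in atTop, σ K₀ L ≤ 1 / ((K₀ : ℝ) + 1) :=
      (hσ0 K₀).eventually (eventually_le_nhds (show (0 : ℝ) < 1 / ((K₀ : ℝ) + 1) by positivity))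
    exact h1.and h2
  have hNge : ∀ K₀ : ℕ, ∀ᶠ L in atTop, K₀ ≤ N L ∧ σ (N L) L ≤ 1 / ((N L : ℝ) + 1) := by
    intro K₀
    filter_upwards [hev K₀] with L hL
    exact ⟨Nat.le_findGreatest hL.1 hL.2, Nat.findGreatest_spec (P := fun K => σ K L ≤ 1 / ((K : ℝ) + 1)) hL.1 hL.2⟩
  refine ⟨N, fun L => σ (N L) L, ?_, ?_, fun L => hσnn _ _, fun L n hn => hρσ _ _ _ hn⟩
  · refine tendsto_atTop_atTop.2 fun K₀ => ?_
    obtain ⟨L₁, hL₁⟩ := eventually_atTop.1 (hNge K₀)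
    exact ⟨L₁, fun L hL => (hL₁ L hL).1⟩
  · refine Metric.tendsto_atTop.2 fun ε hε => ?_
    obtain ⟨K₀, hK₀⟩ := exists_nat_one_div_lt hε
    obtain ⟨L₁, hL₁⟩ := eventually_atTop.1 (hNge K₀)
    refine ⟨L₁, fun L hL => ?_⟩
    obtain ⟨hK, hP⟩ := hL₁ L hL
    rw [Real.dist_eq, sub_zero, abs_of_nonneg (hσnn _ _)]
    have hmono : 1 / ((N L : ℝ) + 1) ≤ 1 / ((K₀ : ℝ) + 1) := by
      apply one_div_le_one_div_of_le (by positivity)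
      exact_mod_cast Nat.succ_le_succ hK
    exact lt_of_le_of_lt (hP.trans hmono) hK₀

/-! ## §2 Cutoff-free: per-label nested rates of the bare carrier give a label-uniform nested rate -/

/-- The Matsubara frequencies beyond a window dominate the window edge: `N < |n| ⇒ k₀(N) ≤ |k₀(n)|` (`k₀(m) = π(2m+1)/β`, `β > 0`). [folklore] -/
theorem fermiMatsubara_le_abs_of_lt {β : ℝ} (hβ : 0 < β) {N : ℕ} {n : ℤ} (h : N < n.natAbs) :
    fermiMatsubara β N ≤ |fermiMatsubara β n| := by
  simp only [fermiMatsubara]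
  rw [abs_div, abs_of_pos hβ, abs_mul, abs_of_pos Real.pi_pos]
  refine div_le_div_of_nonneg_right (mul_le_mul_of_nonneg_left ?_ Real.pi_pos.le) hβ.le
  have hz : (2 * (N : ℤ) + 1 : ℤ) ≤ |2 * n + 1| := by
    rcases le_or_gt 0 n with hn | hn
    · rw [abs_of_nonneg (by omega)]; omega
    · rw [abs_of_neg (by omega)]; omega
  have hr : ((2 * (N : ℤ) + 1 : ℤ) : ℝ) ≤ ((|2 * n + 1| : ℤ) : ℝ) := by exact_mod_cast hz
  push_cast at hr
  simpa [Int.cast_abs] using hr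

/-- `0 < k₀(N)` for a natural label. [folklore] -/
theorem fermiMatsubara_natCast_pos {β : ℝ} (hβ : 0 < β) (N : ℕ) : 0 < fermiMatsubara β N := by
  simp only [fermiMatsubara]; positivity

/-- **Per-label ⇒ label-uniform (cutoff-free nested rate of the bare carrier).**  If for EACH Matsubara integer `n` the cutoff-free bare carrier
`klSelfEnergyInf L β U μ 0 n` is comparable across nested volumes at equal momenta with a rate `ρ n L → 0` (common volume threshold `L₀ ≥ 3`), then ONE
label-uniform rate works: `δ(L) + 18U²/k₀(N(L))` (every real `U`, `β > 0`). -/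
theorem nestedRateInf_uniform_of_perLabel {β : ℝ} (hβ : 0 < β) (U μ : ℝ) {L₀ : ℕ} (hL₀ : 3 ≤ L₀) {ρ : ℤ → ℕ → ℝ}
    (hρ : ∀ n, Tendsto (ρ n) atTop (𝓝 0))
    (h : ∀ (n : ℤ) (L : ℕ) [NeZero L], L₀ ≤ L → ∀ (L'' : ℕ) [NeZero L''], L ∣ L'' →
      ∀ (k : TorusSite 2 L) (k'' : TorusSite 2 L''), latticeMomentum L'' k'' = latticeMomentum L k →
        ‖klSelfEnergyInf L β U μ 0 n k - klSelfEnergyInf L'' β U μ 0 n k''‖ ≤ ρ n L) :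
    ∃ ρ' : ℕ → ℝ, Tendsto ρ' atTop (𝓝 0) ∧ ∀ (L : ℕ) [NeZero L], L₀ ≤ L → ∀ (L'' : ℕ) [NeZero L''], L ∣ L'' →
      ∀ (n : ℤ) (k : TorusSite 2 L) (k'' : TorusSite 2 L''), latticeMomentum L'' k'' = latticeMomentum L k →
        ‖klSelfEnergyInf L β U μ 0 n k - klSelfEnergyInf L'' β U μ 0 n k''‖ ≤ ρ' L := by
  obtain ⟨N, δ, hN, hδ, hδ0, hwin⟩ := exists_labelWindow hρ
  -- the tail constant `18U²/k₀(N L) → 0`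
  have htail : Tendsto (fun L => 18 * U ^ 2 / fermiMatsubara β (N L)) atTop (𝓝 0) := by
    have hk : Tendsto (fun L => fermiMatsubara β (N L)) atTop atTop := by
      have hlin : Tendsto (fun m : ℕ => fermiMatsubara β m) atTop atTop := by
        simp only [fermiMatsubara]
        refine Tendsto.atTop_div_const hβ ?_
        refine Tendsto.const_mul_atTop Real.pi_pos ?_
        exact tendsto_atTop_add_const_right _ 1 (Tendsto.const_mul_atTop two_pos tendsto_natCast_atTop_atTop)
      exact hlin.comp hN
    exact tendsto_const_nhds.div_atTop hk
  refine ⟨fun L => δ L + 18 * U ^ 2 / fermiMatsubara β (N L), by simpa using hδ.add htail, fun L _ hL L'' _ hdvd n k k'' hkk => ?_⟩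
  have hL3 : 3 ≤ L := hL₀.trans hL
  have hL3'' : 3 ≤ L'' := hL3.trans (Nat.le_of_dvd (Nat.pos_of_ne_zero (NeZero.ne L'')) hdvd)
  have hk0 : 0 < fermiMatsubara β (N L) := fermiMatsubara_natCast_pos hβ (N L)
  have htail0 : 0 ≤ 18 * U ^ 2 / fermiMatsubara β (N L) := by positivity
  by_cases hn : n.natAbs ≤ N L
  · exact (h n L hL L'' hdvd k k'' hkk).trans ((hwin L n hn).trans (le_add_of_nonneg_right htail0))
  · rw [not_le] at hn
    -- the density difference, read at the window edge `n = N L`, `k = k″ = 0`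
    have hzero : latticeMomentum L'' (0 : TorusSite 2 L'') = latticeMomentum L (0 : TorusSite 2 L) := by
      funext i; simp [latticeMomentum]
    have hedge := h (N L : ℤ) L hL L'' hdvd 0 0 hzero
    have hedge' : ‖klSelfEnergyInf L β U μ 0 (N L : ℤ) 0 - klSelfEnergyInf L'' β U μ 0 (N L : ℤ) 0‖ ≤ δ L :=
      hedge.trans (hwin L (N L : ℤ) (by simp))
    have hsr_edge := norm_klSelfEnergyInf_zero_sub_sub_le (L := L) hL3 hL3'' hβ U μ (N L : ℤ) (0 : TorusSite 2 L) (0 : TorusSite 2 L'')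
    have hsr_n := norm_klSelfEnergyInf_zero_sub_sub_le (L := L) hL3 hL3'' hβ U μ n k k''
    have hocc : ‖(U : ℂ) * (klOccInf L β U μ - klOccInf L'' β U μ)‖ ≤ δ L + 9 * U ^ 2 / fermiMatsubara β (N L) := by
      have habs : |fermiMatsubara β (N L : ℤ)| = fermiMatsubara β (N L) := abs_of_pos hk0
      have h1 := norm_sub_le_norm_sub_add_norm_sub ((U : ℂ) * (klOccInf L β U μ - klOccInf L'' β U μ))
        (klSelfEnergyInf L β U μ 0 (N L : ℤ) 0 - klSelfEnergyInf L'' β U μ 0 (N L : ℤ) 0) 0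
      rw [sub_zero, sub_zero, norm_sub_rev] at h1
      have h2 : ‖(klSelfEnergyInf L β U μ 0 (N L : ℤ) 0 - klSelfEnergyInf L'' β U μ 0 (N L : ℤ) 0) -
          (U : ℂ) * (klOccInf L β U μ - klOccInf L'' β U μ)‖ ≤ 9 * U ^ 2 / fermiMatsubara β (N L) := by
        simpa [habs] using hsr_edge
      linarith
    -- beyond the window: Hartree sum rule at `n`, then the density difference
    have hkn : fermiMatsubara β (N L) ≤ |fermiMatsubara β n| := fermiMatsubara_le_abs_of_lt hβ hn
    have h3 : 9 * U ^ 2 / |fermiMatsubara β n| ≤ 9 * U ^ 2 / fermiMatsubara β (N L) :=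
      div_le_div_of_nonneg_left (by positivity) hk0 hkn
    calc ‖klSelfEnergyInf L β U μ 0 n k - klSelfEnergyInf L'' β U μ 0 n k''‖
        ≤ ‖(klSelfEnergyInf L β U μ 0 n k - klSelfEnergyInf L'' β U μ 0 n k'') - (U : ℂ) * (klOccInf L β U μ - klOccInf L'' β U μ)‖ +
            ‖(U : ℂ) * (klOccInf L β U μ - klOccInf L'' β U μ)‖ := norm_le_norm_sub_add _ _
      _ ≤ 9 * U ^ 2 / |fermiMatsubara β n| + (δ L + 9 * U ^ 2 / fermiMatsubara β (N L)) := add_le_add hsr_n hocc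
      _ ≤ 9 * U ^ 2 / fermiMatsubara β (N L) + (δ L + 9 * U ^ 2 / fermiMatsubara β (N L)) := by gcongr
      _ = δ L + 18 * U ^ 2 / fermiMatsubara β (N L) := by ring

/-! ## §3 The carrier export of a VL child from PER-LABEL nested finite-cutoff data -/

/-- **PER-LABEL NESTED RATES SUFFICE.**  The carrier-export text of a VL child (any bundle `Pr`, window `W`; at `klPredsV14`/`klWindowC` the registered
`stub_vl_carrierRate` of «cauchy» v3 VERBATIM) from: (Nₙ) for EACH Matsubara integer `n`, nested same-momentum comparability of the bare last-scale self-energy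
at a common cutoff with a label-DEPENDENT rate `ρ n L → 0` (common `L₀`), and (M) the one-volume momentum modulus. -/
theorem carrierRateText_of_perLabelNested (Pr : Preds) (W : Set ℝ)
    (hN : ∀ (G : GeoConsts) (P : SplitConsts) (Q : EngConsts) (R : RenConsts), G.WF → P.WF → Q.WF → R.WF →
      ∃ c₅ : ℝ, 0 < c₅ ∧ ∀ c : ℝ, 0 < c → c ≤ c₅ → ∃ U₀ : ℝ, 0 < U₀ ∧
        ∀ μ ∈ W, ∀ U : ℝ, 0 < U → U ≤ U₀ → ∀ β : ℝ, klBetaMin ≤ β → β ≤ Real.exp (c / U ^ 2) →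
          ∀ K : TrigPolyC4v, Pr.frameOK R U (nScales β) μ K →
            ∀ (Lstar : ℕ) (Mstar : ℕ → ℕ), TowerP Pr G P Q R β U μ K Lstar Mstar →
              ∃ L₀ : ℕ, ∃ ρ : ℤ → ℕ → ℝ, (∀ n, Tendsto (ρ n) atTop (𝓝 0)) ∧
                ∀ (n : ℤ) (L : ℕ) [NeZero L], L₀ ≤ L → ∀ (L'' : ℕ) [NeZero L''], L ∣ L'' → ∃ M₀ : ℕ, ∀ (M : ℕ) [NeZero M], M₀ ≤ M →
                  ∀ (ω : MatsubaraIdx M), matsubaraInt M ω = n → ∀ (k : TorusSite 2 L) (k'' : TorusSite 2 L''),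
                    latticeMomentum L'' k'' = latticeMomentum L k →
                      ‖klSelfEnergy L M β U μ 0 klE0 (nScales β + 1) (ω, k) 0 -
                          klSelfEnergy L'' M β U μ 0 klE0 (nScales β + 1) (ω, k'') 0‖ ≤ ρ n L)
    (hM : ∀ (G : GeoConsts) (P : SplitConsts) (Q : EngConsts) (R : RenConsts), G.WF → P.WF → Q.WF → R.WF →
      ∃ c₅ : ℝ, 0 < c₅ ∧ ∀ c : ℝ, 0 < c → c ≤ c₅ → ∃ U₀ : ℝ, 0 < U₀ ∧
        ∀ μ ∈ W, ∀ U : ℝ, 0 < U → U ≤ U₀ → ∀ β : ℝ, klBetaMin ≤ β → β ≤ Real.exp (c / U ^ 2) →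
          ∀ K : TrigPolyC4v, Pr.frameOK R U (nScales β) μ K →
            ∀ (Lstar : ℕ) (Mstar : ℕ → ℕ), TowerP Pr G P Q R β U μ K Lstar Mstar →
              ∃ L₀ : ℕ, ∃ D : ℝ, ∃ ρ' : ℕ → ℝ, Tendsto ρ' atTop (𝓝 0) ∧
                ∀ (L : ℕ) [NeZero L], L₀ ≤ L → ∃ M₀ : ℕ, ∀ (M : ℕ) [NeZero M], M₀ ≤ M →
                  ∀ (ω : MatsubaraIdx M) (k₁ k₂ : TorusSite 2 L),
                    ‖klSelfEnergy L M β U μ 0 klE0 (nScales β + 1) (ω, k₁) 0 -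
                        klSelfEnergy L M β U μ 0 klE0 (nScales β + 1) (ω, k₂) 0‖ ≤
                      ρ' L + D * ∑ i, torusAbs (latticeMomentum L k₁ i - latticeMomentum L k₂ i)) :
    ∀ (G : GeoConsts) (P : SplitConsts) (Q : EngConsts) (R : RenConsts), G.WF → P.WF → Q.WF → R.WF →
      ∃ c₅ : ℝ, 0 < c₅ ∧ ∀ c : ℝ, 0 < c → c ≤ c₅ → ∃ U₀ : ℝ, 0 < U₀ ∧
        ∀ μ ∈ W, ∀ U : ℝ, 0 < U → U ≤ U₀ → ∀ β : ℝ, klBetaMin ≤ β → β ≤ Real.exp (c / U ^ 2) →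
          ∀ K : TrigPolyC4v, Pr.frameOK R U (nScales β) μ K →
            ∀ (Lstar : ℕ) (Mstar : ℕ → ℕ), TowerP Pr G P Q R β U μ K Lstar Mstar →
              ∃ L₀ : ℕ, ∃ D : ℝ, ∃ ρ : ℕ → ℝ, Tendsto ρ atTop (𝓝 0) ∧
                ∀ (L : ℕ) [NeZero L], L₀ ≤ L → ∀ (L' : ℕ) [NeZero L'], L ≤ L' → ∃ M₀ : ℕ, ∀ (M : ℕ) [NeZero M], M₀ ≤ M →
                  ∀ (ω : MatsubaraIdx M) (k : TorusSite 2 L) (k' : TorusSite 2 L'),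
                    ‖klSelfEnergy L M β U μ 0 klE0 (nScales β + 1) (ω, k) 0 -
                        klSelfEnergy L' M β U μ 0 klE0 (nScales β + 1) (ω, k') 0‖ ≤
                      ρ L + D * ∑ i, torusAbs (latticeMomentum L k i - latticeMomentum L' k' i) := by
  intro G P Q R hG hP hQ hR
  obtain ⟨c₁, hc₁, h₁⟩ := hN G P Q R hG hP hQ hR
  obtain ⟨c₂, hc₂, h₂⟩ := hM G P Q R hG hP hQ hR
  refine ⟨min c₁ c₂, lt_min hc₁ hc₂, fun c hc hcle => ?_⟩
  obtain ⟨U₁, hU₁, h₁'⟩ := h₁ c hc (hcle.trans (min_le_left _ _))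
  obtain ⟨U₂, hU₂, h₂'⟩ := h₂ c hc (hcle.trans (min_le_right _ _))
  refine ⟨min U₁ U₂, lt_min hU₁ hU₂, ?_⟩
  intro μ hμ U hU hUle β hβ hβle K hK Lstar Mstar hT
  have hβ0 : 0 < β := pos_of_klBetaMin_le hβ
  obtain ⟨L₁, ρn, hρn, hnest⟩ := h₁' μ hμ U hU (hUle.trans (min_le_left _ _)) β hβ hβle K hK Lstar Mstar hT
  obtain ⟨L₂, D, ρ', hρ', hmod⟩ := h₂' μ hμ U hU (hUle.trans (min_le_right _ _)) β hβ hβle K hK Lstar Mstar hT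
  set L₀ : ℕ := max (max L₁ L₂) 3 with hL₀
  have hL₀3 : 3 ≤ L₀ := le_max_right _ _
  -- (1) per label, remove the cutoff at both volumes
  have hinfN : ∀ (n : ℤ) (L : ℕ) [NeZero L], L₀ ≤ L → ∀ (L'' : ℕ) [NeZero L''], L ∣ L'' →
      ∀ (k : TorusSite 2 L) (k'' : TorusSite 2 L''), latticeMomentum L'' k'' = latticeMomentum L k →
        ‖klSelfEnergyInf L β U μ 0 n k - klSelfEnergyInf L'' β U μ 0 n k''‖ ≤ ρn n L := by
    intro n L _ hL L'' _ hdvd k k'' hkk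
    have hL3 : 3 ≤ L := hL₀3.trans hL
    have hL3'' : 3 ≤ L'' := hL3.trans (Nat.le_of_dvd (Nat.pos_of_ne_zero (NeZero.ne L'')) hdvd)
    have hL1 : L₁ ≤ L := (le_max_left _ _).trans ((le_max_left _ _).trans hL)
    obtain ⟨M₀, hM₀⟩ := hnest n L hL1 L'' hdvd
    exact kler_carrierRate_of_sameCutoff hβ0 U μ 0 hL3 hL3'' ⟨M₀, fun M _ hMM ω hω => hM₀ M hMM ω hω k k'' hkk⟩
  -- (2) per-label rates become one label-uniform rate
  obtain ⟨ρu, hρu, hnestU⟩ := nestedRateInf_uniform_of_perLabel hβ0 U μ hL₀3 hρn hinfN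
  -- (3) the modulus, cutoff-free (same volume is a nested pair)
  have hmodInf : ∀ (L : ℕ) [NeZero L], L₀ ≤ L → ∀ (n : ℤ) (k₁ k₂ : TorusSite 2 L),
      ‖klSelfEnergyInf L β U μ 0 n k₁ - klSelfEnergyInf L β U μ 0 n k₂‖ ≤
        ρ' L + D * ∑ i, torusAbs (latticeMomentum L k₁ i - latticeMomentum L k₂ i) := by
    intro L _ hL n k₁ k₂
    have hL3 : 3 ≤ L := hL₀3.trans hL
    have hL2 : L₂ ≤ L := (le_max_right _ _).trans ((le_max_left _ _).trans hL)
    obtain ⟨M₀, hM₀⟩ := hmod L hL2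
    exact kler_carrierRate_of_sameCutoff hβ0 U μ 0 hL3 hL3 ⟨M₀, fun M _ hMM ω _ => hM₀ M hMM ω k₁ k₂⟩
  -- (4) nested + modulus ⇒ arbitrary pairs (cutoff-free), then back to finite cutoff
  obtain ⟨ρ₂, hρ₂, hpair⟩ := twoVolumeRate_of_nestedRate (T := fun L _ n k => klSelfEnergyInf L β U μ 0 n k) (L₀ := L₀) (D := D)
    hρu hρ' (fun L _ hL L'' _ hdvd n k k'' hkk => hnestU L hL L'' hdvd n k k'' hkk) (fun L _ hL n k₁ k₂ => hmodInf L hL n k₁ k₂)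
  obtain ⟨L₃, Mth, D', ρ₃, hρ₃, hrate⟩ := twoVolumeRate_of_cutoffFreeRate hβ0 U μ 0 hρ₂ hpair
  refine ⟨L₃, D', ρ₃, hρ₃, fun L _ hL L' _ hLL' => ⟨max (Mth L) (Mth L'), fun M _ hMM ω k k' => ?_⟩⟩
  exact hrate L hL M (le_of_max_le_left hMM) L' hLL' M (le_of_max_le_right hMM) 0 ω ω rfl k k'

end Summit.HubbardSuperconductivity.HubbardSuperconductivity.Theorems.TwoPointAssembly

end
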